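import Mathlib
import HarnessLib
import Literature.Probability.Percolation.QuadCrossingSquareModel
import Literature.Barriers.CriticalPhenomena.EmbeddingModulusUniquenessProofs
import Literature.Probability.RandomPlanarGeometry.ConformalRectangleProofs
import Literature.Probability.RandomPlanarGeometry.ChordalCurveFamily
import Literature.Probability.RandomPlanarGeometry.DiamondShearChart
import Literature.Analysis.OperatorTheory.CoerciveMinimumAnalytic

/-!
# Crux `SegmentOpen` (stmt-CriticalPhenomena-5471), line `Sketch` — stub `stub_shearEnergyAnalytic`

The infimum `E(α)` of the `α`-anisotropic Dirichlet energies over the admissible test functions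
of a conformal rectangle `R'` is real-analytic on `{im α > 0}`: (A) Kato's lemma
`Literature.Analysis.OperatorTheory.analyticAt_sInf_quadratic` (analytic dependence of a coercive
quadratic minimum on its coefficients; Lax–Milgram + `analyticAt_inverse`); (B) realization on
`L²(μ) ⊕ L²(μ)`, `μ` = Lebesgue measure on the carrier (classes of `(∂ₓU, ∂_yU)`), by an operator
family `T α` whose form is the pointwise matrix `[[b + a²/b, −a/b], [−a/b, 1/b]]` (`a = re α`,
`b = im α`), coercive with constant `b / (1 + a² + b²)`, over the submodule of gradients of
finite-energy functions vanishing near both arcs; (C) composition in `α`. Theorems only: the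
operator family is produced existentially (`exists_shearOp`) and the submodule is built inside
the final proof.
-/

noncomputable section

namespace Summit.CriticalPhenomena.CardyFormulaZ2.Theorems

open Literature.Probability Literature.Barriers.CriticalPhenomena
open Literature.Probability.RandomPlanarGeometry (ConformalRectangle ConformalEquiv MarkedDomain)
open Filter Set Topology MeasureTheory
open UpperHalfPlane (upperHalfPlaneSet)
open scoped InnerProductSpace

namespace ShearEnergyAnalytic

/-- Coercivity inequality: `b/(1+a²+b²) (x²+y²) ≤ (b + a²/b) x² − (a/b) 2t + y²/b` if `|t| ≤ xy`. -/
theorem quad_bound (a b x y t : ℝ) (hb : 0 < b) (ht : |t| ≤ x * y) :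
    b / (1 + a ^ 2 + b ^ 2) * (x ^ 2 + y ^ 2) ≤
      (b + a ^ 2 / b) * x ^ 2 + -(a / b) * (t + t) + b⁻¹ * y ^ 2 := by
  have hat : a * t ≤ |a| * (x * y) :=
    (le_abs_self _).trans (by rw [abs_mul]; exact mul_le_mul_of_nonneg_left ht (abs_nonneg a))
  have hDpos : 0 < 1 + a ^ 2 + b ^ 2 := by positivity
  have key' : ∀ A : ℝ, b ^ 2 * (x ^ 2 + y ^ 2) ≤
      (1 + A ^ 2 + b ^ 2) * (b ^ 2 * x ^ 2 + y ^ 2 - 2 * A * x * y + A ^ 2 * x ^ 2) := by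
    intro A
    have iden : (1 + A ^ 2) * ((1 + A ^ 2 + b ^ 2) *
        (b ^ 2 * x ^ 2 + y ^ 2 - 2 * A * x * y + A ^ 2 * x ^ 2) - b ^ 2 * (x ^ 2 + y ^ 2)) =
        ((1 + A ^ 2) * y - A * (1 + A ^ 2 + b ^ 2) * x) ^ 2 + b ^ 4 * x ^ 2 := by ring
    have hsos : 0 ≤ ((1 + A ^ 2) * y - A * (1 + A ^ 2 + b ^ 2) * x) ^ 2 + b ^ 4 * x ^ 2 := by
      positivity
    rw [← iden] at hsos
    have := (mul_nonneg_iff_of_pos_left (by positivity : (0 : ℝ) < 1 + A ^ 2)).1 hsos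
    linarith
  have key := key' |a|
  rw [sq_abs] at key
  have hb' : b ≠ 0 := hb.ne'
  have hQ : (b + a ^ 2 / b) * x ^ 2 + -(a / b) * (t + t) + b⁻¹ * y ^ 2 =
      (b ^ 2 * x ^ 2 + a ^ 2 * x ^ 2 - 2 * a * t + y ^ 2) / b := by
    field_simp; ring
  rw [hQ, le_div_iff₀ hb, div_mul_eq_mul_div, div_mul_eq_mul_div, div_le_iff₀ hDpos]
  have h2 : (1 + a ^ 2 + b ^ 2) * (a * t) ≤ (1 + a ^ 2 + b ^ 2) * (|a| * (x * y)) :=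
    mul_le_mul_of_nonneg_left hat hDpos.le
  nlinarith [key, h2]

/-- **The sheared energy operator family** on `L²(μ) ⊕ L²(μ)`: there is
`T : ℂ → (W →L[ℝ] W)`, `W = WithLp 2 (Lp ℝ 2 μ × Lp ℝ 2 μ)`, with every `T α` symmetric,
`T α` coercive (constant `im α / (1 + re α² + im α²)`) for `im α > 0`, `α ↦ T α` real-analytic
off the real axis, and quadratic form `⟪T α k, k⟫ = ∫ im α p² + (q − re α p)² / im α ∂μ` at any
`k` representing `(p, q)`. Construction: `T α = c₁(α) M₁ + c₂(α) M₂ + c₃(α) M₃` with the blocks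
`(f, g) ↦ (f, 0), (g, f), (0, g)` and `(c₁, c₂, c₃) = (b + a²/b, −a/b, 1/b)`. -/
theorem exists_shearOp (μ : Measure ℂ) :
    ∃ T : ℂ → (WithLp 2 (Lp ℝ 2 μ × Lp ℝ 2 μ) →L[ℝ] WithLp 2 (Lp ℝ 2 μ × Lp ℝ 2 μ)),
      (∀ α u v, ⟪T α u, v⟫_ℝ = ⟪u, T α v⟫_ℝ) ∧
      (∀ α : ℂ, 0 < α.im → ∃ c : ℝ, 0 < c ∧ ∀ u, c * ‖u‖ ^ 2 ≤ ⟪T α u, u⟫_ℝ) ∧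
      (∀ α : ℂ, α.im ≠ 0 → AnalyticAt ℝ T α) ∧
      (∀ (α : ℂ) (p q : ℂ → ℝ), MemLp p 2 μ → MemLp q 2 μ →
        ∀ k : WithLp 2 (Lp ℝ 2 μ × Lp ℝ 2 μ), ((k.fst : ℂ → ℝ) =ᵐ[μ] p) →
          ((k.snd : ℂ → ℝ) =ᵐ[μ] q) →
          ⟪T α k, k⟫_ℝ = ∫ z, (α.im * p z ^ 2 + (q z - α.re * p z) ^ 2 / α.im) ∂μ) := by
  let e := ((WithLp.prodContinuousLinearEquiv 2 ℝ (Lp ℝ 2 μ) (Lp ℝ 2 μ)).symm :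
    Lp ℝ 2 μ × Lp ℝ 2 μ →L[ℝ] WithLp 2 (Lp ℝ 2 μ × Lp ℝ 2 μ))
  let M₁ := e ∘L ContinuousLinearMap.inl ℝ (Lp ℝ 2 μ) (Lp ℝ 2 μ) ∘L
    WithLp.fstL 2 ℝ (Lp ℝ 2 μ) (Lp ℝ 2 μ)
  let M₂ := e ∘L (ContinuousLinearMap.inr ℝ (Lp ℝ 2 μ) (Lp ℝ 2 μ) ∘L
    WithLp.fstL 2 ℝ (Lp ℝ 2 μ) (Lp ℝ 2 μ) + ContinuousLinearMap.inl ℝ (Lp ℝ 2 μ) (Lp ℝ 2 μ) ∘L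
      WithLp.sndL 2 ℝ (Lp ℝ 2 μ) (Lp ℝ 2 μ))
  let M₃ := e ∘L ContinuousLinearMap.inr ℝ (Lp ℝ 2 μ) (Lp ℝ 2 μ) ∘L
    WithLp.sndL 2 ℝ (Lp ℝ 2 μ) (Lp ℝ 2 μ)
  let T : ℂ → (WithLp 2 (Lp ℝ 2 μ × Lp ℝ 2 μ) →L[ℝ] WithLp 2 (Lp ℝ 2 μ × Lp ℝ 2 μ)) :=
    fun α => (α.im + α.re ^ 2 / α.im) • M₁ + (-(α.re / α.im)) • M₂ + (α.im)⁻¹ • M₃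
  have hT : ∀ (α : ℂ) (u v : WithLp 2 (Lp ℝ 2 μ × Lp ℝ 2 μ)), ⟪T α u, v⟫_ℝ =
      (α.im + α.re ^ 2 / α.im) * ⟪u.fst, v.fst⟫_ℝ +
        (-(α.re / α.im)) * (⟪u.snd, v.fst⟫_ℝ + ⟪u.fst, v.snd⟫_ℝ) +
        (α.im)⁻¹ * ⟪u.snd, v.snd⟫_ℝ := by
    intro α u v
    simp [T, M₁, M₂, M₃, e, inner_add_left, real_inner_smul_left]
    ring
  refine ⟨T, fun α u v => ?_, fun α hα => ?_, fun α hα => ?_, fun α p q hp hq k hk1 hk2 => ?_⟩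
  · -- symmetry
    rw [real_inner_comm (T α v) u, hT, hT, real_inner_comm u.fst v.fst,
      real_inner_comm u.fst v.snd, real_inner_comm u.snd v.fst, real_inner_comm u.snd v.snd]
    ring
  · -- coercivity
    refine ⟨α.im / (1 + α.re ^ 2 + α.im ^ 2), by positivity, fun u => ?_⟩
    rw [hT, WithLp.prod_norm_sq_eq_of_L2, real_inner_self_eq_norm_sq,
      real_inner_self_eq_norm_sq, real_inner_comm u.fst u.snd]
    exact quad_bound α.re α.im ‖u.fst‖ ‖u.snd‖ ⟪u.fst, u.snd⟫_ℝ hα (abs_real_inner_le_norm _ _)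
  · -- analyticity
    have hre : AnalyticAt ℝ (fun z : ℂ => z.re) α := Complex.reCLM.analyticAt α
    have him : AnalyticAt ℝ (fun z : ℂ => z.im) α := Complex.imCLM.analyticAt α
    have h1 : AnalyticAt ℝ (fun z : ℂ => z.im + z.re ^ 2 / z.im) α :=
      him.add ((hre.pow 2).div him hα)
    have h2 : AnalyticAt ℝ (fun z : ℂ => -(z.re / z.im)) α := (hre.div him hα).neg
    have h3 : AnalyticAt ℝ (fun z : ℂ => (z.im)⁻¹) α := him.inv hα
    exact ((h1.smul analyticAt_const).add (h2.smul analyticAt_const)).add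
      (h3.smul analyticAt_const)
  · -- the quadratic form: `⟪T α k, k⟫ = ∫ (c₁ p² + 2 c₂ p q + c₃ q²) = ∫ b p² + (q − a p)² / b`
    have hI : ∀ (f g : Lp ℝ 2 μ) (p q : ℂ → ℝ), ((f : ℂ → ℝ) =ᵐ[μ] p) →
        ((g : ℂ → ℝ) =ᵐ[μ] q) → ⟪f, g⟫_ℝ = ∫ z, p z * q z ∂μ := by
      intro f g p q hf hg
      rw [MeasureTheory.L2.inner_def]
      refine integral_congr_ae ?_
      filter_upwards [hf, hg] with z h1 h2
      rw [h1, h2, Real.inner_apply]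
    have ipp : Integrable (fun z => p z * p z) μ := hp.integrable_mul hp
    have ipq : Integrable (fun z => p z * q z) μ := hp.integrable_mul hq
    have iqp : Integrable (fun z => q z * p z) μ := hq.integrable_mul hp
    have iqq : Integrable (fun z => q z * q z) μ := hq.integrable_mul hq
    rw [hT, hI _ _ _ _ hk1 hk1, hI _ _ _ _ hk2 hk1, hI _ _ _ _ hk1 hk2, hI _ _ _ _ hk2 hk2]
    have i1 : Integrable (fun z => (α.im + α.re ^ 2 / α.im) * (p z * p z)) μ := ipp.const_mul _
    have i2 : Integrable (fun z => (-(α.re / α.im)) * (q z * p z + p z * q z)) μ :=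
      (iqp.add ipq).const_mul _
    have i3 : Integrable (fun z => (α.im)⁻¹ * (q z * q z)) μ := iqq.const_mul _
    have i23 : Integrable (fun z => (-(α.re / α.im)) * (q z * p z + p z * q z) +
        (α.im)⁻¹ * (q z * q z)) μ := i2.add i3
    have e1 : ∫ z, (α.im * p z ^ 2 + (q z - α.re * p z) ^ 2 / α.im) ∂μ =
        ∫ z, ((α.im + α.re ^ 2 / α.im) * (p z * p z) + ((-(α.re / α.im)) *
          (q z * p z + p z * q z) + (α.im)⁻¹ * (q z * q z))) ∂μ :=
      integral_congr_ae (ae_of_all _ fun z => by ring)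
    rw [e1, integral_add i1 i23, integral_add i2 i3, integral_const_mul, integral_const_mul,
      integral_const_mul, integral_add iqp ipq]
    ring

/-! #### Finite-energy `C¹` functions on an open set `Ω`, for a measure `μ` carried by `Ω` -/

variable {Ω : Set ℂ} {μ : Measure ℂ}

/-- `C¹` functions on the open set `Ω` are differentiable at its points. -/
theorem diffAt (hΩ : IsOpen Ω) {U : ℂ → ℝ} (hU : ContDiffOn ℝ 1 U Ω) {z : ℂ} (hz : z ∈ Ω) :
    DifferentiableAt ℝ U z :=
  (hU.differentiableOn one_ne_zero).differentiableAt (hΩ.mem_nhds hz)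

/-- Finite energy is preserved under sums (`‖f + g‖² ≤ 2‖f‖² + 2‖g‖²`). -/
theorem energy_add (hΩ : IsOpen Ω) (hμ : ∀ᵐ z ∂μ, z ∈ Ω) {U V : ℂ → ℝ}
    (hU : ContDiffOn ℝ 1 U Ω) (hV : ContDiffOn ℝ 1 V Ω)
    (hUi : Integrable (fun z => ‖fderiv ℝ U z‖ ^ 2) μ)
    (hVi : Integrable (fun z => ‖fderiv ℝ V z‖ ^ 2) μ) :
    Integrable (fun z => ‖fderiv ℝ (U + V) z‖ ^ 2) μ := by
  refine Integrable.mono' ((hUi.const_mul 2).add (hVi.const_mul 2))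
    ((measurable_fderiv ℝ (U + V)).norm.pow_const 2).aestronglyMeasurable ?_
  filter_upwards [hμ] with z hz
  rw [norm_pow, norm_norm, fderiv_add (diffAt hΩ hU hz) (diffAt hΩ hV hz)]
  show _ ≤ 2 * ‖fderiv ℝ U z‖ ^ 2 + 2 * ‖fderiv ℝ V z‖ ^ 2
  have h1 : ‖fderiv ℝ U z + fderiv ℝ V z‖ ^ 2 ≤ (‖fderiv ℝ U z‖ + ‖fderiv ℝ V z‖) ^ 2 :=
    pow_le_pow_left₀ (norm_nonneg _) (norm_add_le _ _) 2
  nlinarith [sq_nonneg (‖fderiv ℝ U z‖ - ‖fderiv ℝ V z‖)]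

/-- Finite energy is preserved under scalar multiples. -/
theorem energy_smul (hΩ : IsOpen Ω) (hμ : ∀ᵐ z ∂μ, z ∈ Ω) {U : ℂ → ℝ} (hU : ContDiffOn ℝ 1 U Ω)
    (hUi : Integrable (fun z => ‖fderiv ℝ U z‖ ^ 2) μ) (c : ℝ) :
    Integrable (fun z => ‖fderiv ℝ (c • U) z‖ ^ 2) μ := by
  refine (hUi.const_mul (c ^ 2)).congr ?_
  filter_upwards [hμ] with z hz
  rw [fderiv_const_smul (diffAt hΩ hU hz) c, norm_smul, mul_pow, Real.norm_eq_abs, sq_abs]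

/-- Finite energy is preserved under differences. -/
theorem energy_sub (hΩ : IsOpen Ω) (hμ : ∀ᵐ z ∂μ, z ∈ Ω) {U V : ℂ → ℝ}
    (hU : ContDiffOn ℝ 1 U Ω) (hV : ContDiffOn ℝ 1 V Ω)
    (hUi : Integrable (fun z => ‖fderiv ℝ U z‖ ^ 2) μ)
    (hVi : Integrable (fun z => ‖fderiv ℝ V z‖ ^ 2) μ) :
    Integrable (fun z => ‖fderiv ℝ (U - V) z‖ ^ 2) μ := by
  have h1 : ContDiffOn ℝ 1 ((-1 : ℝ) • V) Ω := hV.const_smul (-1 : ℝ)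
  have h2 := energy_add hΩ hμ hU h1 hUi (energy_smul hΩ hμ hV hVi (-1))
  rwa [neg_one_smul, ← sub_eq_add_neg] at h2

/-- Boundary conditions (`U = c` on a neighbourhood of `A`, inside `Ω`) add. -/
theorem bc_add {A Ω : Set ℂ} {c d : ℝ} {U V : ℂ → ℝ}
    (hU : ∃ O : Set ℂ, IsOpen O ∧ A ⊆ O ∧ ∀ z ∈ O ∩ Ω, U z = c)
    (hV : ∃ O : Set ℂ, IsOpen O ∧ A ⊆ O ∧ ∀ z ∈ O ∩ Ω, V z = d) :
    ∃ O : Set ℂ, IsOpen O ∧ A ⊆ O ∧ ∀ z ∈ O ∩ Ω, (U + V) z = c + d := by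
  obtain ⟨O, hO, hsub, hval⟩ := hU
  obtain ⟨O', hO', hsub', hval'⟩ := hV
  exact ⟨O ∩ O', hO.inter hO', subset_inter hsub hsub', fun z hz => by
    rw [Pi.add_apply, hval z ⟨hz.1.1, hz.2⟩, hval' z ⟨hz.1.2, hz.2⟩]⟩

/-- Boundary conditions scale. -/
theorem bc_smul {A Ω : Set ℂ} {c : ℝ} {U : ℂ → ℝ}
    (hU : ∃ O : Set ℂ, IsOpen O ∧ A ⊆ O ∧ ∀ z ∈ O ∩ Ω, U z = c) (s : ℝ) :
    ∃ O : Set ℂ, IsOpen O ∧ A ⊆ O ∧ ∀ z ∈ O ∩ Ω, (s • U) z = s * c := by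
  obtain ⟨O, hO, hsub, hval⟩ := hU
  exact ⟨O, hO, hsub, fun z hz => by rw [Pi.smul_apply, hval z hz, smul_eq_mul]⟩

/-- Boundary conditions subtract. -/
theorem bc_sub {A Ω : Set ℂ} {c d : ℝ} {U V : ℂ → ℝ}
    (hU : ∃ O : Set ℂ, IsOpen O ∧ A ⊆ O ∧ ∀ z ∈ O ∩ Ω, U z = c)
    (hV : ∃ O : Set ℂ, IsOpen O ∧ A ⊆ O ∧ ∀ z ∈ O ∩ Ω, V z = d) :
    ∃ O : Set ℂ, IsOpen O ∧ A ⊆ O ∧ ∀ z ∈ O ∩ Ω, (U - V) z = c - d := by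
  have := bc_add hU (bc_smul hV (-1))
  rwa [neg_one_smul, ← sub_eq_add_neg, neg_one_mul, ← sub_eq_add_neg] at this

/-- Directional derivatives of finite-energy functions are square integrable. -/
theorem memLp_fderiv {U : ℂ → ℝ} (hUi : Integrable (fun z => ‖fderiv ℝ U z‖ ^ 2) μ) (v : ℂ)
    (hv : ‖v‖ ≤ 1) : MemLp (fun z => fderiv ℝ U z v) 2 μ := by
  rw [memLp_two_iff_integrable_sq (measurable_fderiv_apply_const ℝ U v).aestronglyMeasurable]
  refine Integrable.mono' hUi
    ((measurable_fderiv_apply_const ℝ U v).pow_const 2).aestronglyMeasurable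
    (Eventually.of_forall fun z => ?_)
  rw [norm_pow, Real.norm_eq_abs, sq_abs]
  have h' : |fderiv ℝ U z v| ≤ ‖fderiv ℝ U z‖ := by
    rw [← Real.norm_eq_abs]; nlinarith [norm_nonneg (fderiv ℝ U z), (fderiv ℝ U z).le_opNorm v]
  exact sq_le_sq' (abs_le.1 h').1 (abs_le.1 h').2

/-- Representation of directional derivatives by `L²` classes is additive. -/
theorem rep_add (hΩ : IsOpen Ω) (hμ : ∀ᵐ z ∂μ, z ∈ Ω) {U V : ℂ → ℝ} {f g : Lp ℝ 2 μ} {v : ℂ}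
    (hU : ContDiffOn ℝ 1 U Ω) (hV : ContDiffOn ℝ 1 V Ω)
    (hf : (f : ℂ → ℝ) =ᵐ[μ] fun z => fderiv ℝ U z v)
    (hg : (g : ℂ → ℝ) =ᵐ[μ] fun z => fderiv ℝ V z v) :
    ((f + g : Lp ℝ 2 μ) : ℂ → ℝ) =ᵐ[μ] fun z => fderiv ℝ (U + V) z v := by
  filter_upwards [Lp.coeFn_add f g, hf, hg, hμ] with z h1 h2 h3 hz
  rw [h1, Pi.add_apply, h2, h3, fderiv_add (diffAt hΩ hU hz) (diffAt hΩ hV hz), add_apply]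

/-- Representation of directional derivatives by `L²` classes is homogeneous. -/
theorem rep_smul (hΩ : IsOpen Ω) (hμ : ∀ᵐ z ∂μ, z ∈ Ω) {U : ℂ → ℝ} {f : Lp ℝ 2 μ} {v : ℂ}
    (hU : ContDiffOn ℝ 1 U Ω) (c : ℝ) (hf : (f : ℂ → ℝ) =ᵐ[μ] fun z => fderiv ℝ U z v) :
    ((c • f : Lp ℝ 2 μ) : ℂ → ℝ) =ᵐ[μ] fun z => fderiv ℝ (c • U) z v := by
  filter_upwards [Lp.coeFn_smul c f, hf, hμ] with z h1 h2 hz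
  rw [h1, Pi.smul_apply, h2, fderiv_const_smul (diffAt hΩ hU hz) c, smul_apply]

variable (μ) in
/-- The zero class represents the derivatives of the zero function. -/
theorem rep_zero (v : ℂ) :
    ((0 : Lp ℝ 2 μ) : ℂ → ℝ) =ᵐ[μ] fun z => fderiv ℝ (0 : ℂ → ℝ) z v := by
  filter_upwards [Lp.coeFn_zero ℝ 2 μ] with z hz
  rw [hz, fderiv_zero]; rfl

/-- Every finite-energy function has a representative of its gradient in `L²(μ) ⊕ L²(μ)`. -/
theorem exists_rep {U : ℂ → ℝ} (hUi : Integrable (fun z => ‖fderiv ℝ U z‖ ^ 2) μ) :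
    ∃ k : WithLp 2 (Lp ℝ 2 μ × Lp ℝ 2 μ), ((k.fst : ℂ → ℝ) =ᵐ[μ] fun z => fderiv ℝ U z 1) ∧
      ((k.snd : ℂ → ℝ) =ᵐ[μ] fun z => fderiv ℝ U z Complex.I) :=
  ⟨WithLp.toLp 2 ((memLp_fderiv hUi 1 (by simp)).toLp _,
      (memLp_fderiv hUi Complex.I (by simp)).toLp _),
    (memLp_fderiv hUi 1 (by simp)).coeFn_toLp, (memLp_fderiv hUi Complex.I (by simp)).coeFn_toLp⟩

end ShearEnergyAnalytic

open ShearEnergyAnalytic in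
/-- **Stub `stub_shearEnergyAnalytic` (AN) of line `Sketch`.** For every conformal rectangle `R'`,
the infimum `E(α)` of the `α`-anisotropic Dirichlet energies over the admissible test functions
of `R'` (`C¹` on the carrier, finite energy, `0` near the arc `0`, `1` near the arc `2`) is
real-analytic on `{im α > 0}`. Proof: with `T` from `exists_shearOp` (`μ` = Lebesgue measure on
the carrier), `b` a representative of `∇U₀` for one admissible `U₀` and `K` the submodule of
representatives of gradients of finite-energy functions vanishing near both arcs, the set of
admissible energies is `{⟪T α (b + k), b + k⟫ : k ∈ K}` (`U ↦ U − U₀`, `V ↦ U₀ + V`); conclude by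
Kato's lemma `Literature.Analysis.OperatorTheory.analyticAt_sInf_quadratic` (an empty admissible
class gives the constant `sInf ∅ = 0`). -/
theorem stub_shearEnergyAnalytic :
    ∀ R' : ConformalRectangle,
      AnalyticOnNhd ℝ (fun α : ℂ => sInf {e : ℝ | ∃ U : ℂ → ℝ,
          (ContDiffOn ℝ 1 U R'.carrier ∧
            IntegrableOn (fun z => ‖fderiv ℝ U z‖ ^ 2) R'.carrier ∧
            (∃ O : Set ℂ, IsOpen O ∧ R'.arc 0 ⊆ O ∧ ∀ z ∈ O ∩ R'.carrier, U z = 0) ∧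
            (∃ O : Set ℂ, IsOpen O ∧ R'.arc 2 ⊆ O ∧ ∀ z ∈ O ∩ R'.carrier, U z = 1)) ∧
          e = ∫ z in R'.carrier, (α.im * (fderiv ℝ U z 1) ^ 2 +
            (fderiv ℝ U z Complex.I - α.re * fderiv ℝ U z 1) ^ 2 / α.im)})
        {α : ℂ | 0 < α.im} := by
  intro R' α₀ hα₀
  have hΩ : IsOpen R'.carrier := R'.isOpen
  have hμ : ∀ᵐ z ∂(volume.restrict R'.carrier), z ∈ R'.carrier :=
    ae_restrict_mem hΩ.measurableSet
  by_cases hne : ∃ U₀ : ℂ → ℝ, ContDiffOn ℝ 1 U₀ R'.carrier ∧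
      IntegrableOn (fun z => ‖fderiv ℝ U₀ z‖ ^ 2) R'.carrier ∧
      (∃ O : Set ℂ, IsOpen O ∧ R'.arc 0 ⊆ O ∧ ∀ z ∈ O ∩ R'.carrier, U₀ z = 0) ∧
      (∃ O : Set ℂ, IsOpen O ∧ R'.arc 2 ⊆ O ∧ ∀ z ∈ O ∩ R'.carrier, U₀ z = 1)
  swap
  · -- empty admissible class: the function is constantly `sInf ∅ = 0`
    refine (analyticAt_const (v := (0 : ℝ))).congr (Eventually.of_forall fun α => ?_)
    symm
    convert Real.sInf_empty using 2
    exact Set.eq_empty_of_forall_notMem fun e ⟨U, hU, _⟩ => hne ⟨U, hU⟩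
  obtain ⟨U₀, h₀, h₀i, h₀0, h₀2⟩ := hne
  obtain ⟨T, hTs, hTc, hTa, hTe⟩ := exists_shearOp (volume.restrict R'.carrier)
  obtain ⟨b, hb1, hb2⟩ := exists_rep h₀i
  -- `K`: representatives of gradients of finite-energy functions vanishing near both arcs
  let K : Submodule ℝ (WithLp 2 (Lp ℝ 2 (volume.restrict R'.carrier) ×
      Lp ℝ 2 (volume.restrict R'.carrier))) :=
    { carrier := {k | ∃ V : ℂ → ℝ, (ContDiffOn ℝ 1 V R'.carrier ∧
          IntegrableOn (fun z => ‖fderiv ℝ V z‖ ^ 2) R'.carrier) ∧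
        ((∃ O : Set ℂ, IsOpen O ∧ R'.arc 0 ⊆ O ∧ ∀ z ∈ O ∩ R'.carrier, V z = 0) ∧
          (∃ O : Set ℂ, IsOpen O ∧ R'.arc 2 ⊆ O ∧ ∀ z ∈ O ∩ R'.carrier, V z = 0)) ∧
        ((k.fst : ℂ → ℝ) =ᵐ[volume.restrict R'.carrier] fun z => fderiv ℝ V z 1) ∧
        ((k.snd : ℂ → ℝ) =ᵐ[volume.restrict R'.carrier] fun z => fderiv ℝ V z Complex.I)}
      add_mem' := by
        rintro k k' ⟨V, ⟨hV, hVi⟩, ⟨hV0, hV2⟩, hk1, hk2⟩ ⟨V', ⟨hV', hVi'⟩, ⟨hV0', hV2'⟩, hk1', hk2'⟩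
        exact ⟨V + V', ⟨hV.add hV', energy_add hΩ hμ hV hV' hVi hVi'⟩,
          ⟨by simpa using bc_add hV0 hV0', by simpa using bc_add hV2 hV2'⟩,
          rep_add hΩ hμ hV hV' hk1 hk1', rep_add hΩ hμ hV hV' hk2 hk2'⟩
      zero_mem' := ⟨0, ⟨contDiffOn_const, by simp [fderiv_zero]⟩,
        ⟨⟨univ, isOpen_univ, subset_univ _, fun _ _ => rfl⟩,
          ⟨univ, isOpen_univ, subset_univ _, fun _ _ => rfl⟩⟩,
        rep_zero _ 1, rep_zero _ Complex.I⟩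
      smul_mem' := by
        rintro c k ⟨V, ⟨hV, hVi⟩, ⟨hV0, hV2⟩, hk1, hk2⟩
        exact ⟨c • V, ⟨hV.const_smul c, energy_smul hΩ hμ hV hVi c⟩,
          ⟨by simpa using bc_smul hV0 c, by simpa using bc_smul hV2 c⟩,
          rep_smul hΩ hμ hV c hk1, rep_smul hΩ hμ hV c hk2⟩ }
  refine (Literature.Analysis.OperatorTheory.analyticAt_sInf_quadratic K b T α₀ (hTa α₀ hα₀.ne')
    hTs (hTc α₀ hα₀)).congr (Eventually.of_forall fun α => ?_)
  show sInf _ = sInf _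
  congr 1
  ext e
  constructor
  · -- `k ∈ K`, represented by `V`: the admissible function `U₀ + V`
    rintro ⟨k, hk, rfl⟩
    obtain ⟨V, ⟨hV, hVi⟩, ⟨hV0, hV2⟩, hk1, hk2⟩ := hk
    have hUi := energy_add hΩ hμ h₀ hV h₀i hVi
    exact ⟨U₀ + V, ⟨h₀.add hV, hUi, by simpa using bc_add h₀0 hV0, by simpa using bc_add h₀2 hV2⟩,
      hTe α _ _ (memLp_fderiv hUi 1 (by simp)) (memLp_fderiv hUi Complex.I (by simp)) (b + k)
        (rep_add hΩ hμ h₀ hV hb1 hk1) (rep_add hΩ hμ h₀ hV hb2 hk2)⟩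
  · -- an admissible `U`: `k` a representative of `∇(U − U₀)`
    rintro ⟨U, ⟨hU, hUi, hU0, hU2⟩, rfl⟩
    have hV : ContDiffOn ℝ 1 (U - U₀) R'.carrier := hU.sub h₀
    have hVi := energy_sub hΩ hμ hU h₀ hUi h₀i
    obtain ⟨k, hk1, hk2⟩ := exists_rep hVi
    have hr1 := rep_add hΩ hμ h₀ hV hb1 hk1
    have hr2 := rep_add hΩ hμ h₀ hV hb2 hk2
    rw [add_sub_cancel] at hr1 hr2
    exact ⟨k, ⟨U - U₀, ⟨hV, hVi⟩, ⟨by simpa using bc_sub hU0 h₀0,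
      by simpa using bc_sub hU2 h₀2⟩, hk1, hk2⟩,
      (hTe α _ _ (memLp_fderiv hUi 1 (by simp)) (memLp_fderiv hUi Complex.I (by simp)) (b + k)
        hr1 hr2).symm⟩

end Summit.CriticalPhenomena.CardyFormulaZ2.Theorems
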